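import Mathlib
import Summits.CriticalPhenomena.PercolationContinuityZ3.Theorems.PercNearOneGluingNoHeavyLowerTailReciprocalCMAllLevels
import HarnessLib

/-!
# Kummer reflection: Region II of CONJECTURE A′ from a Region-I partner at the reflected level `2 − γ`

Support file for the Sahi / Conjecture-P programme of route `PercNearOneGluingNoHeavy`
(`--supports stmt-CriticalPhenomena-4575`, prover prim-l12-p5 gen 41; proof note
`prim-l12-p5/PROOF-REGION-II-KUMMER-REFLECTION-g41.md` §1–§2, §6).  No definitions, no named facts, no sorries.

SETTING (g36–g39 files).  `H a c r = ₂F₁(a, −r; c; g)` (terminating Gauss sum, hypothesis-definition `hH` as in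
`…LowerTailHypergeomSums`), `Q_ν := H (−ν) γ` at level `γ`, `θ = ϑ + 1 ∈ (1,2]`, `ρ := Q_ϑ/Q_θ`.  REGION II of
CONJECTURE A′ (the only part left open by g37's THEOREM A′/THEOREM S) is: `ρ` is completely monotone (CM) for
`0 < γ < 1 − ϑ`.  THE KUMMER-REFLECTION IDENTITY (memo (KR); the Wronskian of the two Kummer/Gauss solutions written through
contiguous functions) is
  `θ · Q_ϑ(m) · P(m) − θ' · Q_θ(m) · P₁(m) = (1 − γ) (1 − g)^{θ' + m}`,   `θ' := θ + γ − 1 = ϑ + γ`,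
where `P(m) = ₂F₁(−θ', 1−γ−m; 2−γ; g)`, `P₁(m) = ₂F₁(1−θ', 1−γ−m; 2−γ; g)` are the level-`(2−γ)` Gauss functions of the
REFLECTED index `θ' ∈ (0,1]` on the shifted lattice `m + γ − 1` (non-terminating series: they are NOT instances of `H`).

This file proves, inside the finite framework:
* `hyp_lower_fst`, `hyp_lower_snd` — the two b-lowering contiguous relations of the terminating family
  (`(c+r) H a c (r+1) = (c−a+r) H a c r + a(1−g) H (a+1) c r` and
   `(c+r) H (a+1) c (r+1) = (c−a−1) H a c r + (a+1+r)(1−g) H (a+1) c r`);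
* `kummerReflect_W_succ`, `kummerReflect_W_eq` — TRANSFER INVARIANCE: for ANY real sequences `P, P₁` obeying the partner step
  relations `(1+m) P(m+1) = (1+m+θ') P(m) − θ'(1−g) P₁(m)`, `(1+m) P₁(m+1) = θ P(m) + (m−ϑ)(1−g) P₁(m)`, the bilinear form
  `W(m) := θ Q_ϑ(m) P(m) − θ' Q_θ(m) P₁(m)` satisfies `W(m+1) = (1−g) W(m)`, hence `W(m) = (1−g)^m W(0)`
  (the 2×2 transfer matrices `M_F, M_P` obey `M_Fᵀ [[0,−θ'],[θ,0]] M_P = (1−g)·[[0,−θ'],[θ,0]]`);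
* **`regionII_ratio_altSum_nonneg_of_partner`** — THEOREM RII GIVEN THE PARTNER: if such `P, P₁` have `W(0) ≥ 0`, `P₁` CM,
  `P > 0` with CM first difference, then `ρ = Q_ϑ/Q_θ` is CM on `ℕ` for every level `γ ∈ (0,1)` — because
  `ρ = (θ'/θ)·P₁·P⁻¹ + (W(0)/θ)·(1−g)^m·Q_θ⁻¹·P⁻¹` and each factor is CM (`Q_θ⁻¹` by THEOREM H′,
  `hyp_inv_altSum_nonneg_le_two_anylevel`; `P⁻¹` by LEMMA DB; products by Leibniz);
* `regionII_oddsDiff_altSum_nonneg_of_partner` — hence the pure-grabber W♯ odds have CM first difference (CONJECTURE A′ at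
  `(θ, γ)`), via g37's `oddsDiff_altSum_nonneg_of_ratio`.
The three hypotheses on the explicit partner (`W(0) = (1−γ)(1−g)^{θ'} > 0`; `P₁(m) = E[(1−gT)^{m+γ−1}]`, `T ~ Beta(1−θ',1+ϑ)`;
`P(0) = (1−γ)∫₀¹ t^{−γ}(1−gt)^{θ'}dt > 0`, `ΔP(m) = (θ'g/(2−γ)) E[(1−gT₂)^{m+γ−1}]`) are Euler Beta integrals (memo §2.1
(ii),(iii), (1.3a)); they are discharged analytically in the memo and are the subject of the companion file
`…KummerReflectionEuler` (interval integrals).  With them, CONJECTURE A′ holds iff `θ + γ ≥ 1` (memo COROLLARY A′).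
-/

namespace Summit.CriticalPhenomena.PercolationContinuityZ3.Theorems

namespace HypergeomCM

open Finset MomentRatioTN
open scoped Nat

section

variable (g : ℝ) (H : ℝ → ℝ → ℕ → ℝ)
  (hH : ∀ a c r, H a c r = ∑ k ∈ range (r + 1), (r.choose k : ℝ) * (-g) ^ k *
    ((∏ i ∈ range k, (a + i)) / (∏ i ∈ range k, (c + i))))
include hH

/-- **First b-lowering relation** (memo (1.3c); DLMF-type `(c−b)F(a,b−1) = (c−a−b)F(a,b) + a(1−z)F(a+1,b)` at `b = −r`):
`(c + r)·H a c (r+1) = (c − a + r)·H a c r + a(1−g)·H (a+1) c r`  (`c > 0`).  Proof: eliminate the two level-`(c+1)` values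
from `hyp_step` at `a` and `a+1` and `hyp_csplit` at `a+1`, then use the a/b relation `hyp_ab`:
`c·(goal) = (c−a−1)·step(a) + ag·csplit(a+1) + a·step(a+1) + c·ab(a)`. -/
theorem hyp_lower_fst (a c : ℝ) (hc : 0 < c) (r : ℕ) :
    (c + r) * H a c (r + 1) = (c - a + r) * H a c r + a * (1 - g) * H (a + 1) c r := by
  have hS0 := hyp_step g H hH a c hc r
  have hC1 := hyp_csplit g H hH (a + 1) c hc r
  have hS1 := hyp_step g H hH (a + 1) c hc r
  have hAB := hyp_ab g H hH a c r
  have hc0 : c ≠ 0 := hc.ne'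
  have key : c * ((c + r) * H a c (r + 1) - ((c - a + r) * H a c r + a * (1 - g) * H (a + 1) c r)) = 0 := by
    linear_combination (c - a - 1) * hS0 + (a * g) * hC1 + a * hS1 + c * hAB
  rcases mul_eq_zero.1 key with h | h
  · exact absurd h hc0
  · exact sub_eq_zero.1 h

/-- **Second b-lowering relation** (memo (1.3c); `(c−b)F(a+1,b−1) = (c−a−1)F(a,b) + (a+1−b)(1−z)F(a+1,b)` at `b = −r`):
`(c + r)·H (a+1) c (r+1) = (c − a − 1)·H a c r + (a + 1 + r)(1−g)·H (a+1) c r`  (`c > 0`; = first relation at `a+1`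
minus Gauss' contiguous relation `hyp_gauss` at `a+1`). -/
theorem hyp_lower_snd (a c : ℝ) (hc : 0 < c) (r : ℕ) :
    (c + r) * H (a + 1) c (r + 1) = (c - a - 1) * H a c r + (a + 1 + r) * (1 - g) * H (a + 1) c r := by
  have h1 := hyp_lower_fst g H hH (a + 1) c hc r
  have h2 := hyp_gauss g H hH r (a + 1) c hc
  rw [show a + 1 - 1 = a by ring] at h2
  linear_combination h1 - h2

end

/-! ### Transfer invariance (abstract sequences) -/

/-- **Transfer step.**  If `F, F₁` obey the b-lowering relations of the level-`γ` family of index `θ` and `P, P₁` those of the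
reflected partner (index `θ' = θ+γ−1`, level `2−γ`, shifted lattice), then the Wronskian form
`W(m) = θ F₁(m) P(m) − θ' F(m) P₁(m)` satisfies `(γ+m)(1+m)·W(m+1) = (γ+m)(1+m)(1−g)·W(m)`. -/
theorem kummerReflect_W_succ_mul (g θ γ : ℝ) (F F₁ P P₁ : ℕ → ℝ) (m : ℕ)
    (hF : (γ + m) * F (m + 1) = (γ + θ + m) * F m - θ * (1 - g) * F₁ m)
    (hF₁ : (γ + m) * F₁ (m + 1) = (θ + γ - 1) * F m + ((m : ℝ) - (θ - 1)) * (1 - g) * F₁ m)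
    (hP : (1 + m) * P (m + 1) = (1 + m + (θ + γ - 1)) * P m - (θ + γ - 1) * (1 - g) * P₁ m)
    (hP₁ : (1 + m) * P₁ (m + 1) = θ * P m + ((m : ℝ) - (θ - 1)) * (1 - g) * P₁ m) :
    (γ + m) * (1 + m) * (θ * F₁ (m + 1) * P (m + 1) - (θ + γ - 1) * F (m + 1) * P₁ (m + 1)) =
      (γ + m) * (1 + m) * ((1 - g) * (θ * F₁ m * P m - (θ + γ - 1) * F m * P₁ m)) := by
  linear_combination (θ * ((1 + (m : ℝ)) * P (m + 1))) * hF₁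
    + (θ * ((θ + γ - 1) * F m + ((m : ℝ) - (θ - 1)) * (1 - g) * F₁ m)) * hP
    - ((θ + γ - 1) * ((1 + (m : ℝ)) * P₁ (m + 1))) * hF
    - ((θ + γ - 1) * ((γ + θ + m) * F m - θ * (1 - g) * F₁ m)) * hP₁

/-- **Transfer invariance** `W(m+1) = (1−g)·W(m)` (`γ > 0`). -/
theorem kummerReflect_W_succ (g θ γ : ℝ) (hγ : 0 < γ) (F F₁ P P₁ : ℕ → ℝ)
    (hF : ∀ m : ℕ, (γ + m) * F (m + 1) = (γ + θ + m) * F m - θ * (1 - g) * F₁ m)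
    (hF₁ : ∀ m : ℕ, (γ + m) * F₁ (m + 1) = (θ + γ - 1) * F m + ((m : ℝ) - (θ - 1)) * (1 - g) * F₁ m)
    (hP : ∀ m : ℕ, (1 + m) * P (m + 1) = (1 + m + (θ + γ - 1)) * P m - (θ + γ - 1) * (1 - g) * P₁ m)
    (hP₁ : ∀ m : ℕ, (1 + m) * P₁ (m + 1) = θ * P m + ((m : ℝ) - (θ - 1)) * (1 - g) * P₁ m) (m : ℕ) :
    θ * F₁ (m + 1) * P (m + 1) - (θ + γ - 1) * F (m + 1) * P₁ (m + 1) =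
      (1 - g) * (θ * F₁ m * P m - (θ + γ - 1) * F m * P₁ m) := by
  have key := kummerReflect_W_succ_mul g θ γ F F₁ P P₁ m (hF m) (hF₁ m) (hP m) (hP₁ m)
  have hne : (γ + m) * (1 + (m : ℝ)) ≠ 0 := by positivity
  exact mul_left_cancel₀ hne key

/-- `W(m) = (1−g)^m · W(0)`. -/
theorem kummerReflect_W_eq (g θ γ : ℝ) (hγ : 0 < γ) (F F₁ P P₁ : ℕ → ℝ)
    (hF : ∀ m : ℕ, (γ + m) * F (m + 1) = (γ + θ + m) * F m - θ * (1 - g) * F₁ m)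
    (hF₁ : ∀ m : ℕ, (γ + m) * F₁ (m + 1) = (θ + γ - 1) * F m + ((m : ℝ) - (θ - 1)) * (1 - g) * F₁ m)
    (hP : ∀ m : ℕ, (1 + m) * P (m + 1) = (1 + m + (θ + γ - 1)) * P m - (θ + γ - 1) * (1 - g) * P₁ m)
    (hP₁ : ∀ m : ℕ, (1 + m) * P₁ (m + 1) = θ * P m + ((m : ℝ) - (θ - 1)) * (1 - g) * P₁ m) (m : ℕ) :
    θ * F₁ m * P m - (θ + γ - 1) * F m * P₁ m = (1 - g) ^ m * (θ * F₁ 0 * P 0 - (θ + γ - 1) * F 0 * P₁ 0) := by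
  induction m with
  | zero => simp
  | succ n ih =>
    rw [kummerReflect_W_succ g θ γ hγ F F₁ P P₁ hF hF₁ hP hP₁ n, ih, pow_succ]
    ring

/-! ### THEOREM RII given the partner -/

section

variable (g : ℝ) (H : ℝ → ℝ → ℕ → ℝ)
  (hH : ∀ a c r, H a c r = ∑ k ∈ range (r + 1), (r.choose k : ℝ) * (-g) ^ k *
    ((∏ i ∈ range k, (a + i)) / (∏ i ∈ range k, (c + i))))
include hH

/-- **THEOREM RII given the reflected partner** (memo §2.1, §6.1).  Let `0 ≤ g < 1`, `ϑ ∈ (0,1]`, `γ > 0`, `θ = ϑ+1`,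
`θ' = ϑ+γ`, and let `P, P₁ : ℕ → ℝ` satisfy the partner step relations, `P > 0` with completely monotone first difference,
`P₁` completely monotone, and `θ·P(0) − θ'·P₁(0) ≥ 0`.  Then `m ↦ Q_ϑ(m)/Q_θ(m) = H (−ϑ) γ m / H (−ϑ−1) γ m` is completely
monotone: all Hausdorff differences are `≥ 0`.  (For the explicit partner `P(m) = ₂F₁(−θ',1−γ−m;2−γ;g)`,
`P₁(m) = ₂F₁(1−θ',1−γ−m;2−γ;g)` the hypotheses hold when `ϑ+γ ≤ 1`, `γ < 1` — memo §2.1 — which is REGION II.) -/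
theorem regionII_ratio_altSum_nonneg_of_partner (hg0 : 0 ≤ g) (hg1 : g < 1) (ϑ γ : ℝ) (h0 : 0 < ϑ) (h1 : ϑ ≤ 1)
    (hγ : 0 < γ) (P P₁ : ℕ → ℝ)
    (hP : ∀ m : ℕ, (1 + m) * P (m + 1) = (1 + m + (ϑ + γ)) * P m - (ϑ + γ) * (1 - g) * P₁ m)
    (hP₁ : ∀ m : ℕ, (1 + m) * P₁ (m + 1) = (ϑ + 1) * P m + ((m : ℝ) - ϑ) * (1 - g) * P₁ m)
    (hW0 : 0 ≤ (ϑ + 1) * P 0 - (ϑ + γ) * P₁ 0)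
    (hPpos : ∀ m, 0 < P m)
    (hΔP : ∀ k j, 0 ≤ ∑ i ∈ range (k + 1), (-1 : ℝ) ^ i * (k.choose i : ℝ) * (P (j + i + 1) - P (j + i)))
    (hP₁cm : ∀ k j, 0 ≤ ∑ i ∈ range (k + 1), (-1 : ℝ) ^ i * (k.choose i : ℝ) * P₁ (j + i))
    (k j : ℕ) :
    0 ≤ ∑ i ∈ range (k + 1), (-1 : ℝ) ^ i * (k.choose i : ℝ) * (H (-ϑ) γ (j + i) / H (-ϑ - 1) γ (j + i)) := by
  -- the terminating family: F = Q_θ, F₁ = Q_ϑ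
  set F : ℕ → ℝ := fun m => H (-ϑ - 1) γ m with hFdef
  set F₁ : ℕ → ℝ := fun m => H (-ϑ) γ m with hF₁def
  have hFpos : ∀ m, 0 < F m := fun m => hyp_pos g H hH hg0 hg1 (-ϑ - 1) m γ hγ (by linarith)
  have hF : ∀ m : ℕ, (γ + m) * F (m + 1) = (γ + (ϑ + 1) + m) * F m - (ϑ + 1) * (1 - g) * F₁ m := by
    intro m
    have h := hyp_lower_fst g H hH (-ϑ - 1) γ hγ m
    simp only [hFdef, hF₁def]
    rw [show -ϑ - 1 + 1 = -ϑ by ring] at h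
    linear_combination h
  have hF₁ : ∀ m : ℕ, (γ + m) * F₁ (m + 1) =
      ((ϑ + 1) + γ - 1) * F m + ((m : ℝ) - ((ϑ + 1) - 1)) * (1 - g) * F₁ m := by
    intro m
    have h := hyp_lower_snd g H hH (-ϑ - 1) γ hγ m
    simp only [hFdef, hF₁def]
    rw [show -ϑ - 1 + 1 = -ϑ by ring] at h
    linear_combination h
  have hP' : ∀ m : ℕ, (1 + m) * P (m + 1) =
      (1 + m + ((ϑ + 1) + γ - 1)) * P m - ((ϑ + 1) + γ - 1) * (1 - g) * P₁ m := by
    intro m; rw [hP m]; ring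
  have hP₁' : ∀ m : ℕ, (1 + m) * P₁ (m + 1) = (ϑ + 1) * P m + ((m : ℝ) - ((ϑ + 1) - 1)) * (1 - g) * P₁ m := by
    intro m; rw [hP₁ m]; ring
  -- W(m) = h^m W(0)
  have hW : ∀ m : ℕ, (ϑ + 1) * F₁ m * P m - (ϑ + γ) * F m * P₁ m =
      (1 - g) ^ m * ((ϑ + 1) * P 0 - (ϑ + γ) * P₁ 0) := by
    intro m
    have h := kummerReflect_W_eq g (ϑ + 1) γ hγ F F₁ P P₁ hF hF₁ hP' hP₁' m
    have hF0 : F 0 = 1 := hyp_zero g H hH (-ϑ - 1) γ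
    have hF₁0 : F₁ 0 = 1 := hyp_zero g H hH (-ϑ) γ
    rw [hF0, hF₁0] at h
    linear_combination h
  -- the decomposition ρ = A·P₁·P⁻¹ + B·h^m·F⁻¹·P⁻¹
  set A : ℝ := (ϑ + γ) / (ϑ + 1) with hAdef
  set B : ℝ := ((ϑ + 1) * P 0 - (ϑ + γ) * P₁ 0) / (ϑ + 1) with hBdef
  have hA0 : 0 ≤ A := by rw [hAdef]; positivity
  have hB0 : 0 ≤ B := by rw [hBdef]; positivity
  have hdec : ∀ m : ℕ, H (-ϑ) γ m / H (-ϑ - 1) γ m =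
      A * (P₁ m * (P m)⁻¹) + B * ((1 - g) ^ m * ((F m)⁻¹ * (P m)⁻¹)) := by
    intro m
    have h := hW m
    have hF0 : (F m) ≠ 0 := (hFpos m).ne'
    have hP0 : (P m) ≠ 0 := (hPpos m).ne'
    have hθ : (ϑ + 1) ≠ 0 := by positivity
    rw [show H (-ϑ) γ m = F₁ m from rfl, show H (-ϑ - 1) γ m = F m from rfl, hAdef, hBdef]
    field_simp
    linear_combination h
  -- complete monotonicity of the pieces
  have hPinv : ∀ k j, 0 ≤ ∑ i ∈ range (k + 1), (-1 : ℝ) ^ i * (k.choose i : ℝ) * (P (j + i))⁻¹ :=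
    altSum_inv_nonneg P hPpos hΔP
  have hFinv : ∀ k j, 0 ≤ ∑ i ∈ range (k + 1), (-1 : ℝ) ^ i * (k.choose i : ℝ) * (F (j + i))⁻¹ :=
    fun k j => hyp_inv_altSum_nonneg_le_two_anylevel g H hH hg0 hg1 γ hγ ϑ h0 h1 k j
  have hgeom : ∀ k j, 0 ≤ ∑ i ∈ range (k + 1), (-1 : ℝ) ^ i * (k.choose i : ℝ) * (1 - g) ^ (j + i) :=
    fun k j => altSum_geom_nonneg (1 - g) (by linarith) (by linarith) k j
  have h1st : ∀ k j, 0 ≤ ∑ i ∈ range (k + 1), (-1 : ℝ) ^ i * (k.choose i : ℝ) * (P₁ (j + i) * (P (j + i))⁻¹) :=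
    altSum_mul_nonneg P₁ (fun m => (P m)⁻¹) hP₁cm hPinv
  have h2nd : ∀ k j, 0 ≤ ∑ i ∈ range (k + 1), (-1 : ℝ) ^ i * (k.choose i : ℝ) *
      ((1 - g) ^ (j + i) * ((F (j + i))⁻¹ * (P (j + i))⁻¹)) :=
    altSum_mul_nonneg (fun m => (1 - g) ^ m) (fun m => (F m)⁻¹ * (P m)⁻¹) hgeom
      (altSum_mul_nonneg (fun m => (F m)⁻¹) (fun m => (P m)⁻¹) hFinv hPinv)
  -- assemble
  have hsplit : (∑ i ∈ range (k + 1), (-1 : ℝ) ^ i * (k.choose i : ℝ) * (H (-ϑ) γ (j + i) / H (-ϑ - 1) γ (j + i))) =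
      A * ∑ i ∈ range (k + 1), (-1 : ℝ) ^ i * (k.choose i : ℝ) * (P₁ (j + i) * (P (j + i))⁻¹) +
      B * ∑ i ∈ range (k + 1), (-1 : ℝ) ^ i * (k.choose i : ℝ) *
        ((1 - g) ^ (j + i) * ((F (j + i))⁻¹ * (P (j + i))⁻¹)) := by
    rw [mul_sum, mul_sum, ← sum_add_distrib]
    refine sum_congr rfl fun i _ => ?_
    rw [hdec (j + i)]
    ring
  rw [hsplit]
  exact add_nonneg (mul_nonneg hA0 (h1st k j)) (mul_nonneg hB0 (h2nd k j))

/-- **CONJECTURE A′ at `(θ, γ)`, `θ = ϑ+1 ∈ (1,2]`, given the reflected partner**: the pure-grabber W♯ odds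
`a_m = m·P_θ(m−1)/(γ·Q_θ(m))` have completely monotone first difference (g37's THEOREM E(i),
`oddsDiff_altSum_nonneg_of_ratio`, on top of `regionII_ratio_altSum_nonneg_of_partner`). -/
theorem regionII_oddsDiff_altSum_nonneg_of_partner (hg0 : 0 ≤ g) (hg1 : g < 1) (ϑ γ : ℝ) (h0 : 0 < ϑ) (h1 : ϑ ≤ 1)
    (hγ : 0 < γ) (P P₁ : ℕ → ℝ)
    (hP : ∀ m : ℕ, (1 + m) * P (m + 1) = (1 + m + (ϑ + γ)) * P m - (ϑ + γ) * (1 - g) * P₁ m)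
    (hP₁ : ∀ m : ℕ, (1 + m) * P₁ (m + 1) = (ϑ + 1) * P m + ((m : ℝ) - ϑ) * (1 - g) * P₁ m)
    (hW0 : 0 ≤ (ϑ + 1) * P 0 - (ϑ + γ) * P₁ 0)
    (hPpos : ∀ m, 0 < P m)
    (hΔP : ∀ k j, 0 ≤ ∑ i ∈ range (k + 1), (-1 : ℝ) ^ i * (k.choose i : ℝ) * (P (j + i + 1) - P (j + i)))
    (hP₁cm : ∀ k j, 0 ≤ ∑ i ∈ range (k + 1), (-1 : ℝ) ^ i * (k.choose i : ℝ) * P₁ (j + i))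
    (k j : ℕ) :
    0 ≤ ∑ i ∈ range (k + 1), (-1 : ℝ) ^ i * (k.choose i : ℝ) *
      ((((j + i + 1 : ℕ) : ℝ)) * H (-(ϑ + 1)) (γ + 1) (j + i + 1 - 1) / (γ * H (-(ϑ + 1)) γ (j + i + 1)) -
        (((j + i : ℕ) : ℝ)) * H (-(ϑ + 1)) (γ + 1) (j + i - 1) / (γ * H (-(ϑ + 1)) γ (j + i))) := by
  have hQ : ∀ m, 0 < H (-(ϑ + 1)) γ m := fun m => hyp_pos g H hH hg0 hg1 (-(ϑ + 1)) m γ hγ (by linarith)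
  refine oddsDiff_altSum_nonneg_of_ratio g H hH hg0 hg1 (ϑ + 1) γ (by linarith) hγ hQ (fun k j => ?_) k j
  have h := regionII_ratio_altSum_nonneg_of_partner g H hH hg0 hg1 ϑ γ h0 h1 hγ P P₁ hP hP₁ hW0 hPpos hΔP hP₁cm k j
  have e1 : (1 : ℝ) - (ϑ + 1) = -ϑ := by ring
  have e2 : -(ϑ + 1) = -ϑ - 1 := by ring
  rw [e1, e2]
  exact h

end

end HypergeomCM

end Summit.CriticalPhenomena.PercolationContinuityZ3.Theorems
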